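import Literature.Analysis.FluidPDE.ElgindiAprioriBlowupProofs
import Literature.Analysis.FluidPDE.BeiraoDaVeigaVorticityCriterion
import Literature.Analysis.FluidPDE.VorticityCalculus
import HarnessLib

/-!
# Elgindi–Ghoul–Masmoudi 2021: the `C^{1,α}` Euler blow-up survives SWIRL perturbations
# (Thm 1 + Rem 1.1 + Thm 2 with the swirl unknown `𝒰^φ`), and the Beale–Kato–Majda criterion
# cannot be improved to `L^p`, `p < ∞`, in the `C^{1,α}` class (Cor 1.3) — two named facts, their
# elementary consequences, and the viscous contrast (proved from the tree's Beirão da Veiga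
# criterion)

Topic `Literature/Analysis/FluidPDE`. Statements file on the source `[ElgindiGhoulMasmoudi2021]`
T. M. Elgindi, T.-E. Ghoul, N. Masmoudi, *On the stability of self-similar blow-up for `C^{1,α}`
solutions to the incompressible Euler equations on `ℝ³`*, Camb. J. Math. **9** (2021) 1035–1075 =
arXiv:1910.14071 ("p." = chunk `pNNNN` of the held text `paper:arxiv-1910.14071`), §1.3 and §2.5–2.6.

## What the tree already has from this source, and what it weakened away

Every declaration of the tree citing this paper is the **swirl-free** reading: the named fact
`Elgindi.ElgindiGhoulMasmoudi2021_stabilityCore` (`ElgindiStabilityDecomposition.lean`: Elgindi's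
profile and "Theorem 2, swirl-free, k = 4", docstring: "Weakenings only: no uniqueness, no swirl, …"),
the named fact `elgindi_euler_blowup` (`Axisymmetric.lean`, **ns.S29 (i)**: slices axisymmetric AND
swirl-free, blow-up at `t = 1`), and their proof architecture (`ElgindiBlowup*.lean`,
`ElgindiStableBlowupPhysical.lean`, `ElgindiAprioriBlowupProofs.lean`). The printed paper does more:

* §1.4, p. 4: "Recall that `Ḡ` is axi-symmetric without swirl. Thus, there are several levels at
  which this question [stability] can be asked: first, within the class of axi-symmetric solutions
  without swirl; second, within the class of general axi-symmetric solutions; finally, among general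
  solutions to the 3D Euler equation. For this work, we content ourselves with answering the first
  and second questions." … "the stability of the profile with respect to perturbations with swirl is
  only due to a matching of constants that shows that the linearized operator coming from the
  equation for the swirl is not worse than that of the axial vorticity."
* §1.3 **Theorem 1**, p. 3: "There is a continuum of `α > 0` for which there exists a divergence-free
  `u₀ ∈ C^{1,α}(ℝ³)` with compactly supported initial vorticity `ω₀ ∈ C^α(ℝ³)` so that the unique
  local solution to (1.1)–(1.3) belonging to the class `L² ∩ C^{1,α}_{x,t}([0,1) × ℝ³)` satisfies
  `lim_{t→1} ∫₀ᵗ |ω(s)|_{L^∞} ds = +∞`. Moreover, the blow-up is stable in a sense that is specified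
  in Theorem 2." **Remark 1.1**, p. 3: "The proof proceeds by showing that the self-similar solution
  constructed in [Elgindi 2021] is stable with respect to perturbations in a space that allows for the
  full solution to be compactly supported. In fact, the perturbations are allowed to have non-trivial
  swirl." **Remark 1.2**, p. 3: "If we take `α` smaller and smaller, the blow-up becomes more and more
  mild. In particular, a consequence of our result is the following corollary." **Corollary 1.3**,
  p. 3: "In the class of all `L² ∩ C^{1,α}` solutions to the 3D Euler equations, it is not possible
  to strengthen the Beale–Kato–Majda criterion in the scale of `L^p` spaces. In particular, for
  every `p < ∞`, there exists a classical solution to the 3D Euler equation for which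
  `sup_{t ∈ [0,T_*)} ‖ω‖_{L^p} < ∞` while `lim_{t → T_*} ∫₀ᵗ ‖ω‖_{L^∞} = +∞`."
* §2.1, p. 7: the axisymmetric Euler system WITH swirl,
  `∂ₜu^φ + u_r∂_r u^φ + u_3∂_3 u^φ = −r⁻¹u_r u^φ`,
  `∂ₜω + u_r∂_rω + u_3∂_3ω = r⁻¹u_rω + 2r⁻¹u^φ∂_3u^φ`; §2.2: `u^φ = ρ U^φ(R, θ)`, `R = ρ^α`;
  §2.3, p. 8: the modulated self-similar system for `(W, 𝒰^φ, Φ_W, λ, μ)`, linearised around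
  `(F, 0, Φ_F)`, with `∂_y𝒰^φ(0, θ, s) = 0` "propagated once we assume it initially".
* §2.5 **Definition 2.1** / **Theorem 2**, p. 9: "Fix `k ≥ 4`. For `ε ∈ 𝓗ᵏ` and `𝒰^φ ∈ 𝓗^{k+1}`
  with `tan(θ)𝒰^φ ∈ 𝓗ᵏ`, define
  `𝓔(ε, 𝒰^φ) = ‖ε‖_{𝓗ᵏ} + ‖𝒰^φ‖_{𝓗^{k+1}} + ‖∂_θ𝒰^φ‖_{𝓗ᵏ} + ‖tan(θ)𝒰^φ‖_{𝓗ᵏ}`." "For `k ≥ 4`,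
  there exists `α₀ > 0` small so that for all `α < α₀`, there is a `δ₀ > 0` and `κ > 0` so that for
  every initial `(ε₀, 𝒰₀^φ)` with `𝓔(ε₀, 𝒰₀^φ) < δ₀α^{3/2}` and `L₁₂(ε₀)(0) = 0`, there is an
  associated unique global solution to (2.x) so that
  `|μ_s| + |λ_s/λ + 1| + 𝓔(ε, 𝒰^φ)(s) ≤ C𝓔(ε₀, 𝒰₀^φ)e^{−κs}` for all `s ≥ 0`." **Corollary 2.2**:
  "there exists `T_*` so that `λ(s)exp(s) → 1/T_* ≈ 1`"; §2.6, p. 9 ("Solutions with compactly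
  supported vorticity and finite energy"): "it suffices to show that there exists `ε₀ ∈ 𝓗ᵏ` with
  small norm so that `F + ε₀` is compactly supported. We take `𝒰₀^φ` to be compactly supported."

## Rendering (two named facts, net debt +2; everything else proved)

* `ElgindiGhoulMasmoudi2021.swirlPerturbedBlowup` — **Thm 1 + Rem 1.1/1.2 + Thm 2 (the `𝒰^φ`
  component) + Cor 2.2 + §2.6, read in physical variables exactly as the tree reads the swirl-free
  case** (the former `ElgindiGhoulMasmoudi2021_blowupSolution`, now the hypothesis of
  `elgindi_euler_blowup_of_blowupSolution`, `ElgindiAprioriBlowupProofs.lean`): for every `α₀ > 0`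
  there are `α ∈ (0, α₀)` (Rem 1.2: `α` may be taken smaller and smaller; Thm 2: all `α < α₀`), a
  time `T > 0` (the `T_*` of Cor 2.2), a datum `u₀` which is axisymmetric with NON-TRIVIAL swirl
  (`¬ HasNoSwirl u₀`: take `𝒰₀^φ ≢ 0` small and compactly supported in Thm 2 / §2.6), and a solution
  `(u, p)` of the Hölder class `IsHolderEulerSolution α (Ico 0 T) u₀ u p` (classical Euler solution
  on `ℝ³`, `u 0 = u₀`, slices `C^{1,α}` with finite energy and compactly supported vorticity, `C^{1,α}`
  norms bounded on compact sub-intervals — the class "`L² ∩ C^{1,α}_{x,t}`" of Thm 1 with the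
  compact vorticity support of §2.6) with axisymmetric slices, whose Beale–Kato–Majda integral
  diverges at `T`: `lim_{t ↑ T} ∫_{(0,t)} ‖ω(s)‖_{L^∞} ds = +∞`. This is logically independent of
  `elgindi_euler_blowup` (which asserts swirl-FREE slices) and of `…_stabilityCore` (swirl datum
  zero): it is the printed swirl clause, not a restatement. NOT rendered: uniqueness ("the unique
  local solution"), the open-set / exponential-decay content of Thm 2 in the `𝓗ᵏ` topology, the
  self-similar asymptotics and the collapse exponent (which are those of the swirl-free profile:
  `z = R/λ^{1+δ}`, §2.3 — the tree's `Elgindi.collapseExponent`), the location of the singular point.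
* `ElgindiGhoulMasmoudi2021.noLpBKMCriterion` — **Cor 1.3 as printed**: for every finite `p ≥ 1`
  there are `α > 0`, `T > 0` and a classical Euler solution on `ℝ³ × [0, T)` with `L² ∩ C^{1,α}`
  slices and locally bounded `C^{1,α}` norms, with `sup_{[0,T)} ‖ω(t)‖_{L^p} < ∞` and
  `∫₀ᵗ ‖ω‖_{L^∞} → ∞` as `t ↑ T`. (The paper's `p < ∞` is read as `1 ≤ p < ∞`, the `L^p` scale;
  asserting fewer exponents is weaker than print.)

Proved here: the `limsup` form of blow-up for any solution of the Hölder class with divergent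
Beale–Kato–Majda integral (`IsHolderEulerSolution.vorticityBlowsUpAt_of_tendsto`, the argument of
`elgindi_euler_blowup_of_bkmBlowupAt`); swirl is homogeneous under amplitude scaling
(`swirl_const_smul`, `not_hasNoSwirl_const_smul`); the **with-swirl twin of ns.S29 (i)**
`swirlPerturbedBlowup.exists_blowup_at_one` (blow-up time normalised to `1` by the Euler time
scaling of `EulerBlowupScaling.lean`, datum NOT swirl-free); `noLpBKMCriterion.exists_vorticityBlowsUpAt`;
and the viscous contrast `hasSmoothExtensionPast_of_eLpNorm_curl_le` (below).

## What transfers to `ν > 0` (the D-0081 §A4 topic-2 question), as far as the kernel knows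

* The swirl-free members of the Elgindi family (Elgindi 2021, this paper with `𝒰^φ ≡ 0`,
  Córdoba–Martínez-Zoroa–Zheng 2023, Chen 2026-II, Shkoller 2026) launch GLOBAL smooth
  Navier–Stokes solutions at every `ν > 0` (`axisymmetric_no_swirl_global_regularity_holds` for smooth
  data; `GallaySverak2015.L1VorticityGlobalExistence.of_noSwirlDatum_viscosity` for the `C^{1,α}`
  data, modulo that one named fact), and the Elgindi–Pasqualotto swirl-driven ring
  (`ElgindiPasqualotto2023.swirlDrivenHolderBlowup`, a claim) is singular OFF the axis, where
  axisymmetric suitable weak solutions of Navier–Stokes are regular (`AxisymmetricSingularSetOnAxis.lean`).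
  The fact `swirlPerturbedBlowup` is the one printed `C^{1,α}` finite-energy Euler blow-up on `ℝ³`
  WITH swirl collapsing at a point of the axis (the origin, §2.3: `z = R/λ^{1+δ}`, `R = ρ^α`): neither
  exclusion applies to its datum. Nothing is asserted here about its viscous evolution.
* Cor 1.3 does NOT transfer: for a classical Leray–Hopf Navier–Stokes solution on `ℝ³ × [0,T)`,
  `ν > 0`, a bound `sup_{[0,T)} ‖ω(t)‖_{L^r} < ∞` with ANY finite `r > 3/2` continues the solution
  past `T` — `hasSmoothExtensionPast_of_eLpNorm_curl_le`, proved below from the tree's THEOREM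
  `BeiraoDaVeiga1995_vorticityCriterion` (Beirão da Veiga, C. R. Acad. Sci. Paris 321 (1995);
  `ω ∈ L^q(0,T; L^r)`, `2/q + 3/r = 2`) by choosing `q = 2r/(2r − 3)` and using that a uniform
  slice bound on a bounded interval is an `L^q_t` bound (`memLqLp_of_ae_eLpNorm_le`).

WHAT THIS IS NOT: not Navier–Stokes blow-up or regularity claims — two printed EULER statements typed
as cited Props (unasserted hypotheses `(h : …)` for their users) and kernel-proved readings; the one
Navier–Stokes theorem of this file is a corollary of an already-proved tree theorem.

## References

* T. M. Elgindi, T.-E. Ghoul, N. Masmoudi, Camb. J. Math. 9 (2021) 1035–1075 = arXiv:1910.14071,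
  §1.3 Thm 1, Rem 1.1–1.2, Cor 1.3 (p. 3); §1.4 (p. 4); §2.1–2.3 (p. 7–8); §2.5 Def 2.1, Thm 2,
  Cor 2.2, §2.6 (p. 9). [ElgindiGhoulMasmoudi2021]
* T. M. Elgindi, Ann. of Math. 194 (2021) = arXiv:1904.04795, §1.3 Thm 1 (the swirl-free profile).
  [Elgindi2021]
* H. Beirão da Veiga, C. R. Acad. Sci. Paris Sér. I 321 (1995) 405–408 (vorticity criterion, as
  restated by Chae, Rev. Mat. Iberoam. 23 (2007) p. 372 (1.8)). [BeiraoDaVeiga1995CR]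
* A. J. Majda, A. L. Bertozzi, *Vorticity and Incompressible Flow*, CUP 2002, Thm 3.6 / (3.72)
  (the Beale–Kato–Majda criterion and its `sup` reading). [MajdaBertozziCUP2002]
-/

noncomputable section

open MeasureTheory Set Function Filter
open _root_.Topology
open scoped NNReal ENNReal

namespace Literature.Analysis.FluidPDE

/-! ### Generic consequences in the Hölder class (proved) -/

/-- **The `limsup` form of blow-up in the Hölder class.** A solution of the class
`IsHolderEulerSolution γ [0, T) u₀` whose Beale–Kato–Majda integral diverges at `T`,
`lim_{t ↑ T} ∫_{(0,t)} ‖ω(s)‖_{L^∞} ds = ∞`, has `limsup_{t ↑ T} ‖ω(t)‖_∞ = ∞`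
(`VorticityBlowsUpAt u T`): the locally uniform `C^{1,γ}` bounds give `‖ω(t)‖_∞ ≤ 4‖u(t)‖_{C^{1,γ}}`
on every `[0, T']`, `T' < T` (`eSupNorm_curl_le_of_eContDiffHolderNorm_le`), and
`vorticityBlowsUpAt_of_lintegral_eSupNorm_curl` concludes — the argument of
`elgindi_euler_blowup_of_bkmBlowupAt`, recorded for any datum (swirl or not). [cite: MajdaBertozziCUP2002, Thm 3.6 / (3.72): the Beale–Kato–Majda criterion and its `sup` reading] -/
theorem IsHolderEulerSolution.vorticityBlowsUpAt_of_tendsto {γ : ℝ≥0} {T : ℝ}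
    {u₀ : EuclideanSpace ℝ (Fin 3) → EuclideanSpace ℝ (Fin 3)}
    {u : ℝ → EuclideanSpace ℝ (Fin 3) → EuclideanSpace ℝ (Fin 3)}
    {p : ℝ → EuclideanSpace ℝ (Fin 3) → ℝ} (h : IsHolderEulerSolution γ (Ico 0 T) u₀ u p)
    (hblow : Tendsto (fun t : ℝ => ∫⁻ s in Ioo 0 t, FunctionSpaces.eSupNorm (curl (u s)))
      (𝓝[<] T) (𝓝 ∞)) :
    VorticityBlowsUpAt u T := by
  refine vorticityBlowsUpAt_of_lintegral_eSupNorm_curl (fun T' hT' => ?_)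
    (lintegral_Ioo_eq_top_of_tendsto hblow)
  obtain ⟨C, hC⟩ := h.bound_of_lt hT'
  exact ⟨4 * C, ENNReal.mul_lt_top (by simp) ENNReal.coe_lt_top, fun t ht =>
    eSupNorm_curl_le_of_eContDiffHolderNorm_le (hC t ht)⟩

/-- The swirl `Γ = x₀u₁ − x₁u₀ = r u_θ` (KNSS 2009, (1.8), the tree's `swirl`) is linear in the
field, in particular homogeneous under amplitude rescaling: `Γ(a v) = a Γ(v)`. [cite: KNSS2009, §1 (1.8): `Γ := r u_θ`, linear in `u`] -/
theorem swirl_const_smul (a : ℝ) (v : EuclideanSpace ℝ (Fin 3) → EuclideanSpace ℝ (Fin 3))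
    (x : EuclideanSpace ℝ (Fin 3)) :
    swirl (fun y => a • v y) x = a * swirl v x := by
  simp only [swirl, PiLp.smul_apply, smul_eq_mul]
  ring

/-- Non-trivial swirl is preserved by a non-zero amplitude rescaling (the converse direction of the
tree's `HasNoSwirl.const_smul`; `Γ(a v) = a Γ(v)` with `a ≠ 0`). [cite: KNSS2009, §1 (1.8): `Γ := r u_θ`, linear in `u`] -/
theorem not_hasNoSwirl_const_smul {v : EuclideanSpace ℝ (Fin 3) → EuclideanSpace ℝ (Fin 3)}
    (hv : ¬ HasNoSwirl v) {a : ℝ} (ha : a ≠ 0) : ¬ HasNoSwirl (fun y => a • v y) := by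
  intro h
  apply hv
  intro x
  have hx := h x
  rw [swirl_const_smul] at hx
  exact (mul_eq_zero.1 hx).resolve_left ha

namespace ElgindiGhoulMasmoudi2021

/-! ### The two named facts -/

/-- **Elgindi–Ghoul–Masmoudi 2021: the `C^{1,α}` blow-up with NON-TRIVIAL SWIRL** (Camb. J. Math.
9 (2021) = arXiv:1910.14071). Printed: §1.3 **Thm 1**, p. 3: "There is a continuum of `α > 0` for
which there exists a divergence-free `u₀ ∈ C^{1,α}(ℝ³)` with compactly supported initial vorticity
`ω₀ ∈ C^α(ℝ³)` so that the unique local solution … belonging to the class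
`L² ∩ C^{1,α}_{x,t}([0,1) × ℝ³)` satisfies `lim_{t→1} ∫₀ᵗ |ω(s)|_{L^∞} ds = +∞`. Moreover, the
blow-up is stable in a sense that is specified in Theorem 2"; **Rem 1.1**: "the perturbations are
allowed to have non-trivial swirl"; **Rem 1.2**: "If we take `α` smaller and smaller, the blow-up
becomes more and more mild"; §2.5 **Thm 2**, p. 9, whose energy
`𝓔(ε, 𝒰^φ) = ‖ε‖_{𝓗ᵏ} + ‖𝒰^φ‖_{𝓗^{k+1}} + ‖∂_θ𝒰^φ‖_{𝓗ᵏ} + ‖tan(θ)𝒰^φ‖_{𝓗ᵏ}` (Def 2.1) carries the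
swirl unknown `𝒰^φ` (`u^φ = ρ U^φ(R,θ)`, §2.2): "for all `α < α₀` … for every initial `(ε₀, 𝒰₀^φ)`
with `𝓔(ε₀, 𝒰₀^φ) < δ₀α^{3/2}` and `L₁₂(ε₀)(0) = 0`, there is an associated unique global solution …
`|μ_s| + |λ_s/λ + 1| + 𝓔(ε, 𝒰^φ)(s) ≤ C𝓔(ε₀, 𝒰₀^φ)e^{−κs}`"; **Cor 2.2** (the physical blow-up time
`T_*`, "`λ(s)exp(s) → 1/T_* ≈ 1`"); §2.6, p. 9: "We take `𝒰₀^φ` to be compactly supported"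
(compactly supported vorticity and finite energy). **Rendering** (module docstring; the physical
reading of §2.1–2.3 exactly as in the tree's swirl-free `elgindi_euler_blowup_of_blowupSolution`):
for every `α₀ > 0` there are `0 < α < α₀`, a time `T > 0`, an axisymmetric datum `u₀` with
non-trivial swirl, and a solution `(u, p)` of the Hölder class `IsHolderEulerSolution α [0, T) u₀`
(classical Euler on `ℝ³`, `u 0 = u₀`, slices `C^{1,α}` with finite energy and compactly supported
vorticity, locally bounded `C^{1,α}` norms) with axisymmetric slices, whose Beale–Kato–Majda
integral diverges at `T`. Not rendered: uniqueness, the open set of admissible perturbations and the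
exponential convergence to the profile, the self-similar exponent, the singular point. Divergence-freeness,
the `C^{1,α}` class, finite energy and compact vorticity support of `u₀` are the `t = 0` slice clauses. [cite: ElgindiGhoulMasmoudi2021, §1.3 Thm 1 with Rem 1.1–1.2 (p. 3 of arXiv:1910.14071); §1.4 (p. 4); §2.5 Def 2.1, Thm 2, Cor 2.2 and §2.6 (p. 9); §2.1–2.3 (p. 7–8)] -/
def swirlPerturbedBlowup : Prop :=
  ∀ α₀ : ℝ≥0, 0 < α₀ → ∃ α : ℝ≥0, 0 < α ∧ α < α₀ ∧
    ∃ (T : ℝ) (u₀ : EuclideanSpace ℝ (Fin 3) → EuclideanSpace ℝ (Fin 3))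
      (u : ℝ → EuclideanSpace ℝ (Fin 3) → EuclideanSpace ℝ (Fin 3))
      (p : ℝ → EuclideanSpace ℝ (Fin 3) → ℝ), 0 < T ∧
      IsAxisymmetric u₀ ∧ ¬ HasNoSwirl u₀ ∧
      IsHolderEulerSolution α (Ico 0 T) u₀ u p ∧
      (∀ t ∈ Ico 0 T, IsAxisymmetric (u t)) ∧
      Tendsto (fun t : ℝ => ∫⁻ s in Ioo 0 t, FunctionSpaces.eSupNorm (curl (u s)))
        (𝓝[<] T) (𝓝 ∞)

/-- **Elgindi–Ghoul–Masmoudi 2021, Corollary 1.3: the Beale–Kato–Majda criterion cannot be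
strengthened in the scale of `L^p` spaces, in the `C^{1,α}` class** (Camb. J. Math. 9 (2021) =
arXiv:1910.14071, §1.3, p. 3). Printed: "In the class of all `L² ∩ C^{1,α}` solutions to the 3D Euler
equations, it is not possible to strengthen the Beale–Kato–Majda criterion in the scale of `L^p`
spaces. In particular, for every `p < ∞`, there exists a classical solution to the 3D Euler equation
for which `sup_{t ∈ [0,T_*)} ‖ω‖_{L^p} < ∞` while `lim_{t→T_*} ∫₀ᵗ ‖ω‖_{L^∞} = +∞`" (Rem 1.2: a
consequence of Thm 1 with `α` small). **Rendering**: for every exponent `1 ≤ p < ∞` there are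
`α > 0`, `T > 0` and a classical solution `(u, P)` of the incompressible Euler equations (`f = 0`) on
`ℝ³ × [0, T)` (`IsClassicalEulerOnDomain (Ico 0 T) ⊤ 0 0 u P`) whose slices are `C^{1,α}`
(`MemC1Holder`) with finite energy, with `C^{1,α}` norms bounded on every `[0, T']`, `T' < T` (the class
`C^{1,α}_{x,t}` on compact sub-intervals, minus its time-Hölder part), with
`‖ω(t)‖_{L^p} ≤ C < ∞` for all `t ∈ [0, T)` and `∫_{(0,t)} ‖ω(s)‖_{L^∞} ds → ∞` as `t ↑ T`. The
printed `p < ∞` is read on the `L^p` scale `1 ≤ p`; compact vorticity support is not asserted (it is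
not in the corollary's sentence). [cite: ElgindiGhoulMasmoudi2021, §1.3 Cor 1.3 with Rem 1.2 (p. 3 of arXiv:1910.14071)] -/
def noLpBKMCriterion : Prop :=
  ∀ q : ℝ≥0∞, 1 ≤ q → q < ∞ →
    ∃ (α : ℝ≥0) (T : ℝ) (u : ℝ → EuclideanSpace ℝ (Fin 3) → EuclideanSpace ℝ (Fin 3))
      (P : ℝ → EuclideanSpace ℝ (Fin 3) → ℝ), 0 < α ∧ 0 < T ∧
      IsClassicalEulerOnDomain (Ico 0 T) (⊤ : TopologicalSpace.Opens (EuclideanSpace ℝ (Fin 3)))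
        0 0 u P ∧
      (∀ t ∈ Ico 0 T, MemC1Holder α (u t) ∧ HasFiniteEnergy (u t)) ∧
      (∀ T' < T, ∃ C : ℝ≥0, ∀ t ∈ Icc 0 T', FunctionSpaces.eContDiffHolderNorm 1 α (u t) ≤ C) ∧
      (∃ C : ℝ≥0∞, C < ∞ ∧ ∀ t ∈ Ico 0 T, eLpNorm (curl (u t)) q volume ≤ C) ∧
      Tendsto (fun t : ℝ => ∫⁻ s in Ioo 0 t, FunctionSpaces.eSupNorm (curl (u s)))
        (𝓝[<] T) (𝓝 ∞)

/-! ### Consequences of the swirl fact (proved) -/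

/-- From the fact: the blow-up solution with swirl has `limsup_{t ↑ T} ‖ω(t)‖_∞ = ∞`, for
arbitrarily small `α`. [cite: ElgindiGhoulMasmoudi2021, §1.3 Thm 1 with Rem 1.1 (p. 3)] -/
theorem swirlPerturbedBlowup.exists_vorticityBlowsUpAt (h : swirlPerturbedBlowup) {α₀ : ℝ≥0}
    (hα₀ : 0 < α₀) :
    ∃ α : ℝ≥0, 0 < α ∧ α < α₀ ∧
      ∃ (T : ℝ) (u₀ : EuclideanSpace ℝ (Fin 3) → EuclideanSpace ℝ (Fin 3))
        (u : ℝ → EuclideanSpace ℝ (Fin 3) → EuclideanSpace ℝ (Fin 3))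
        (p : ℝ → EuclideanSpace ℝ (Fin 3) → ℝ), 0 < T ∧ ¬ HasNoSwirl u₀ ∧
        IsHolderEulerSolution α (Ico 0 T) u₀ u p ∧ VorticityBlowsUpAt u T := by
  obtain ⟨α, hα, hαα₀, T, u₀, u, p, hT, -, hsw, hsol, -, hblow⟩ := h α₀ hα₀
  exact ⟨α, hα, hαα₀, T, u₀, u, p, hT, hsw, hsol, hsol.vorticityBlowsUpAt_of_tendsto hblow⟩

/-- **The with-swirl twin of ns.S29 (i).** From the fact: there are `α > 0` and a classical
solution `(u, p)` of the incompressible Euler equations (`f = 0`) on `ℝ³ × [0, 1)` with `C^{1,α}`,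
finite-energy, axisymmetric slices, whose datum `u 0` is NOT swirl-free, and whose vorticity blows up
at `t = 1` (`limsup_{t ↑ 1} ‖ω(t)‖_∞ = ∞`) — the shape of `elgindi_euler_blowup` with `HasNoSwirl`
replaced by its negation at `t = 0`. The blow-up time `T` of the fact is normalised to `1` by the Euler
time scaling `u ↦ T u(Tt, ·)`, `p ↦ T² p(Tt, ·)` (`IsClassicalEulerOnDomain.timeRescale_zero`,
`VorticityBlowsUpAt.timeRescale`, `EulerTimeScaling.lean` / `EulerBlowupScaling.lean`), which
multiplies the swirl of the datum by `T ≠ 0` (`not_hasNoSwirl_const_smul`). [cite: ElgindiGhoulMasmoudi2021, §1.3 Thm 1 with Rem 1.1 (p. 3); Cor 2.2 (p. 9): the blow-up time] -/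
theorem swirlPerturbedBlowup.exists_blowup_at_one (h : swirlPerturbedBlowup) :
    ∃ α : ℝ≥0, 0 < α ∧
      ∃ (u : ℝ → EuclideanSpace ℝ (Fin 3) → EuclideanSpace ℝ (Fin 3))
        (p : ℝ → EuclideanSpace ℝ (Fin 3) → ℝ),
        IsClassicalEulerOnDomain (Ico 0 1) (⊤ : TopologicalSpace.Opens (EuclideanSpace ℝ (Fin 3)))
          0 0 u p ∧
        (∀ t ∈ Ico (0 : ℝ) 1, MemC1Holder α (u t) ∧ HasFiniteEnergy (u t) ∧ IsAxisymmetric (u t)) ∧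
        ¬ HasNoSwirl (u 0) ∧ VorticityBlowsUpAt u 1 := by
  obtain ⟨α, hα, -, T, u₀, u, p, hT, -, hsw, hsol, hax, hblow⟩ := h 1 one_pos
  have hV : VorticityBlowsUpAt u T := hsol.vorticityBlowsUpAt_of_tendsto hblow
  refine ⟨α, hα, FluidPDE.timeRescale T T u, FluidPDE.timeRescale T (T ^ 2) p, ?_, ?_, ?_, ?_⟩
  · have := hsol.euler.timeRescale_zero hT
    rwa [div_self hT.ne'] at this
  · intro t ht
    have hmaps := mapsTo_mul_Ico hT T
    rw [div_self hT.ne'] at hmaps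
    obtain ⟨h1, h2, -⟩ := hsol.slice (T * t) (hmaps ht)
    rw [timeRescale_slice]
    exact ⟨h1.const_smul T, h2.const_smul T, (hax _ (hmaps ht)).const_smul T⟩
  · rw [timeRescale_slice, mul_zero, hsol.initial]
    exact not_hasNoSwirl_const_smul hsw hT.ne'
  · have := hV.timeRescale hT
    rwa [div_self hT.ne'] at this

/-- From the fact: the datum of the with-swirl blow-up solution is outside the swirl-free class, so
neither the swirl-free global-regularity theorem of Navier–Stokes
(`axisymmetric_no_swirl_global_regularity_holds`) nor the swirl-free Euler theory
(`Danchin2007.noSwirlHolderGlobal`, `MajdaBertozzi2002_axisymNoSwirlGlobal`) speaks about it: there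
is a time in `[0, T)` (namely `t = 0`) at which the solution has swirl. [cite: ElgindiGhoulMasmoudi2021, §1.3 Rem 1.1 (p. 3)] -/
theorem swirlPerturbedBlowup.not_forall_hasNoSwirl (h : swirlPerturbedBlowup) {α₀ : ℝ≥0}
    (hα₀ : 0 < α₀) :
    ∃ α : ℝ≥0, 0 < α ∧ α < α₀ ∧
      ∃ (T : ℝ) (u₀ : EuclideanSpace ℝ (Fin 3) → EuclideanSpace ℝ (Fin 3))
        (u : ℝ → EuclideanSpace ℝ (Fin 3) → EuclideanSpace ℝ (Fin 3))
        (p : ℝ → EuclideanSpace ℝ (Fin 3) → ℝ), 0 < T ∧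
        IsHolderEulerSolution α (Ico 0 T) u₀ u p ∧ VorticityBlowsUpAt u T ∧
        ¬ ∀ t ∈ Ico 0 T, HasNoSwirl (u t) := by
  obtain ⟨α, hα, hαα₀, T, u₀, u, p, hT, -, hsw, hsol, -, hblow⟩ := h α₀ hα₀
  refine ⟨α, hα, hαα₀, T, u₀, u, p, hT, hsol, hsol.vorticityBlowsUpAt_of_tendsto hblow, fun hall => ?_⟩
  have h0 := hall 0 ⟨le_rfl, hT⟩
  rw [hsol.initial] at h0
  exact hsw h0

/-! ### Consequence of Corollary 1.3 (proved) -/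

/-- From Cor 1.3: for every finite `p ≥ 1`, a finite-energy `C^{1,α}` classical Euler solution on
`ℝ³ × [0, T)` with `sup_{[0,T)} ‖ω(t)‖_{L^p} < ∞` and nevertheless `limsup_{t ↑ T} ‖ω(t)‖_∞ = ∞`
(`vorticityBlowsUpAt_of_lintegral_eSupNorm_curl` with the local `C^{1,α}` bounds). [cite: ElgindiGhoulMasmoudi2021, §1.3 Cor 1.3 (p. 3)] -/
theorem noLpBKMCriterion.exists_vorticityBlowsUpAt (h : noLpBKMCriterion) {q : ℝ≥0∞} (h1q : 1 ≤ q)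
    (hqtop : q < ∞) :
    ∃ (α : ℝ≥0) (T : ℝ) (u : ℝ → EuclideanSpace ℝ (Fin 3) → EuclideanSpace ℝ (Fin 3))
      (P : ℝ → EuclideanSpace ℝ (Fin 3) → ℝ), 0 < α ∧ 0 < T ∧
      IsClassicalEulerOnDomain (Ico 0 T) (⊤ : TopologicalSpace.Opens (EuclideanSpace ℝ (Fin 3)))
        0 0 u P ∧
      (∀ t ∈ Ico 0 T, MemC1Holder α (u t) ∧ HasFiniteEnergy (u t)) ∧
      (∃ C : ℝ≥0∞, C < ∞ ∧ ∀ t ∈ Ico 0 T, eLpNorm (curl (u t)) q volume ≤ C) ∧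
      VorticityBlowsUpAt u T := by
  obtain ⟨α, T, u, P, hα, hT, hsol, hslice, hunif, hLp, hblow⟩ := h q h1q hqtop
  refine ⟨α, T, u, P, hα, hT, hsol, hslice, hLp, ?_⟩
  refine vorticityBlowsUpAt_of_lintegral_eSupNorm_curl (fun T' hT' => ?_)
    (lintegral_Ioo_eq_top_of_tendsto hblow)
  obtain ⟨C, hC⟩ := hunif T' hT'
  exact ⟨4 * C, ENNReal.mul_lt_top (by simp) ENNReal.coe_lt_top, fun t ht =>
    eSupNorm_curl_le_of_eContDiffHolderNorm_le (hC t ht)⟩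

end ElgindiGhoulMasmoudi2021

/-! ### The viscous contrast to Corollary 1.3 (proved from the tree's Beirão da Veiga criterion) -/

/-- **The Beirão da Veiga time exponent.** For a finite space exponent `r > 3/2` the conjugate
time exponent `q = 2r/(2r − 3)` satisfies `1 < q < ∞` and `2/q + 3/r = 2`. [cite: Chae2007RMI, p. 372 (1.8): the exponent relation of Beirão da Veiga's criterion] -/
theorem exists_bdv_timeExponent {r : ℝ≥0∞} (hr : 3 / 2 < r) (hrtop : r ≠ ∞) :
    ∃ q : ℝ≥0∞, 1 < q ∧ q < ∞ ∧ 2 / q + 3 / r = 2 := by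
  -- the real exponent `ρ = r.toReal > 3/2`
  set ρ : ℝ := r.toReal with hρ
  have hr' : r = ENNReal.ofReal ρ := (ENNReal.ofReal_toReal hrtop).symm
  have h32 : (3 : ℝ) / 2 < ρ := by
    have h := (ENNReal.toReal_lt_toReal (ENNReal.div_ne_top (by norm_num) (by norm_num)) hrtop).2 hr
    have h32' : ((3 : ℝ≥0∞) / 2).toReal = 3 / 2 := by
      rw [ENNReal.toReal_div]; norm_num
    rwa [h32'] at h
  have hρpos : 0 < ρ := lt_trans (by norm_num) h32
  have hden : 0 < 2 * ρ - 3 := by linarith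
  set a : ℝ := 2 * ρ / (2 * ρ - 3) with ha
  have hapos : 0 < a := div_pos (by linarith) hden
  have ha1 : 1 < a := by
    rw [ha, lt_div_iff₀ hden]; linarith
  refine ⟨ENNReal.ofReal a, ?_, ENNReal.ofReal_lt_top, ?_⟩
  · rw [← ENNReal.ofReal_one]
    exact (ENNReal.ofReal_lt_ofReal_iff hapos).2 ha1
  · rw [hr']
    have h2 : (2 : ℝ≥0∞) = ENNReal.ofReal 2 := by simp
    have h3 : (3 : ℝ≥0∞) = ENNReal.ofReal 3 := by simp
    rw [h2, h3, ← ENNReal.ofReal_div_of_pos hapos, ← ENNReal.ofReal_div_of_pos hρpos,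
      ← ENNReal.ofReal_add (by positivity) (by positivity)]
    congr 1
    rw [ha]
    field_simp
    ring

/-- **For `ν > 0` a uniform `L^r` vorticity bound with ANY finite `r > 3/2` excludes blow-up** —
the Navier–Stokes contrast to `ElgindiGhoulMasmoudi2021.noLpBKMCriterion`. Let `ν > 0`, `T > 0`
and let `(u, p)` be a classical solution of the unforced Navier–Stokes system on `ℝ³ × [0, T)`,
Leray–Hopf from its rapidly decaying datum `u 0`. If `‖ω(t)‖_{L^r} ≤ C < ∞` for all `t ∈ [0, T)`
with `3/2 < r < ∞`, then `u` extends to a classical solution past `T`. Proof: with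
`q = 2r/(2r−3)` (`exists_bdv_timeExponent`) the bound is an `L^q(0,T; L^r)` bound on the bounded
interval (`memLqLp_of_ae_eLpNorm_le`; the slices `curl u(t)` are continuous, hence measurable), and
the tree's THEOREM `BeiraoDaVeiga1995_vorticityCriterion` applies. (For `C^{1,α}` Euler no finite `p`
suffices: Cor 1.3.) [cite: Chae2007RMI, p. 372 (1.8) (restating Beirão da Veiga, C. R. Acad. Sci. Paris 321 (1995) 405–408)] -/
theorem hasSmoothExtensionPast_of_eLpNorm_curl_le {ν T : ℝ} (hν : 0 < ν) (hT : 0 < T)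
    {u : ℝ → EuclideanSpace ℝ (Fin 3) → EuclideanSpace ℝ (Fin 3)}
    {p : ℝ → EuclideanSpace ℝ (Fin 3) → ℝ} (hns : IsClassicalNSSolutionOn (Ico 0 T) ν 0 u p)
    (hlh : IsLerayHopfOn T ν 0 (u 0) u) (hdec : HasRapidSpatialDecay (u 0))
    {r : ℝ≥0∞} (hr : 3 / 2 < r) (hrtop : r ≠ ∞) {C : ℝ≥0∞} (hC : C ≠ ∞)
    (hbd : ∀ t ∈ Ico 0 T, eLpNorm (curl (u t)) r volume ≤ C) :
    HasSmoothExtensionPast ν 0 u T := by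
  obtain ⟨q, h1q, hqtop, hqr⟩ := exists_bdv_timeExponent hr hrtop
  refine BeiraoDaVeiga1995_vorticityCriterion ν T hν hT u p hns hlh hdec q r h1q hqtop hqr ?_
  refine memLqLp_of_ae_eLpNorm_le hC measure_Ioo_lt_top.ne ?_ ?_
  · refine (ae_restrict_iff' measurableSet_Ioo).2 (Eventually.of_forall fun t ht => ?_)
    have htI : t ∈ Ico 0 T := Ioo_subset_Ico_self ht
    have hsm : ContDiff ℝ 1 (u t) := (hns.contDiff_velocity htI).of_le (by norm_cast)
    exact ⟨(continuous_curl hsm).aestronglyMeasurable, (hbd t htI).trans_lt hC.lt_top⟩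
  · exact (ae_restrict_iff' measurableSet_Ioo).2
      (Eventually.of_forall fun t ht => hbd t (Ioo_subset_Ico_self ht))

end Literature.Analysis.FluidPDE
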